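import Summits.MatrixMultiplication.OmegaCensus.Dicyclic40Law
import Summits.MatrixMultiplication.OmegaCensus.DicyclicLawClassification
import HarnessLib

/-!
# `β(C₂² × G) = (32|A| − 32)/3` for every dicyclic-type `G = G(A, c₀)` with `A/⟨c₀⟩` cyclic, `|A| ≡ 1 (mod 3)`

ω-census, family (b3).  Framing: lottery ticket; floor = certified bounds/negative ranges.

Let `G` be of dicyclic type over `A` (`c₀ ≠ 0`), `|A| ≡ 1 (mod 3)`, `|A| ≥ 14`, with `A/⟨c₀⟩` cyclic — exactly the groups
attaining the law `3V + 8 = 8|A|` (`dicyclic_type_mod_one_law_iff`: `Q_{4m}` with `m ≡ 2 (mod 3)`, `ℤ_n ⋊ ℤ₄` with `n ≡ 2 (mod 3)`,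
…).  Then `C₂² × G = G(ℤ₂ × (ℤ₂ × A), (0,(0,c₀)))` has `|A'| = 4|A| ≡ 1 (mod 3)`, `|A'| ≥ 56`, and a NON-cyclic quotient
(`⊇ ℤ₂²`), so the P3 exclusion gives `3V' + 32 ≤ 32|A|` (`tpp_volume_dicyclic_quot_noncyclic_le`), while `(C₂², 1, 1) ×` a law
triple of `G` gives `3V' + 32 = 4(3V + 8) = 32|A|`:
**`c2c2_dicyclic_law_of_quot_cyclic`: β(C₂² × G) = (32|A| − 32)/3 = 4β(G) − 8`** — the common source of the `m ≡ 2 (mod 3)` case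
of `c2c2_quaternion_law` and the `n ≡ 2 (mod 3)` case of `c2c2_semidirect_law`, now for every such `G` (e.g. over non-cyclic `A`
with cyclic `A/⟨c₀⟩`, `A = ℤ₂ × ℤ_{2j}` with `c₀ = (1, j)`-type involutions).
-/

namespace Summit.MatrixMultiplication.OmegaCensus

open Literature.Combinatorics.Additive Finset
open Summit.MatrixMultiplication.MatrixMultiplication.Theorems.JuntaBranch.Planting (tpp_product)

section C2C2G

variable {A : Type} [AddCommGroup A] [Fintype A] [DecidableEq A] {G : Type} [Group G] [DecidableEq G]
  {ρ τ : A → G} {c₀ : A}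

omit [Fintype A] [DecidableEq A] in
/-- `(ℤ₂ × (ℤ₂ × A))/⟨(0,(0,c₀))⟩ ⊇ ℤ₂²` is not cyclic. [folklore] -/
theorem z2_z2_prod_quot_noncyclic (c₀ : A) :
    ¬ ∃ g : ZMod 2 × (ZMod 2 × A), ∀ x, x ∈ AddSubgroup.zmultiples g ∨
      x + ((0 : ZMod 2), (((0 : ZMod 2), c₀))) ∈ AddSubgroup.zmultiples g := by
  rintro ⟨g, hg⟩
  apply not_cyclic_zmod_two_prod (k := 2) (dvd_refl 2)
  refine ⟨(g.1, g.2.1), fun y => ?_⟩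
  have key : ∀ e : A, ((y.1, (y.2, e)) : ZMod 2 × (ZMod 2 × A)) ∈ AddSubgroup.zmultiples g →
      y ∈ AddSubgroup.zmultiples (g.1, g.2.1) := by
    intro e he
    obtain ⟨k, hk⟩ := AddSubgroup.mem_zmultiples_iff.1 he
    refine AddSubgroup.mem_zmultiples_iff.2 ⟨k, ?_⟩
    have h1 := congrArg Prod.fst hk
    have h2 := congrArg (fun p : ZMod 2 × (ZMod 2 × A) => p.2.1) hk
    simp only [Prod.smul_fst, Prod.smul_snd] at h1 h2
    exact Prod.ext h1 h2
  rcases hg (y.1, (y.2, 0)) with h | h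
  · exact key 0 h
  · refine key c₀ ?_
    have e : ((y.1, (y.2, (0 : A))) : ZMod 2 × (ZMod 2 × A)) + (0, (0, c₀)) = (y.1, (y.2, c₀)) :=
      Prod.ext (add_zero _) (Prod.ext (add_zero _) (zero_add _))
    rw [e] at h; exact h

/-- **`β(C₂² × G) = (32|A| − 32)/3` for dicyclic-type `G` over `A` with `A/⟨c₀⟩` cyclic, `|A| ≡ 1 (mod 3)`, `|A| ≥ 14`**:
every TPP triple of `C₂² × G` has `3V + 32 ≤ 32|A|`, with equality attained. [folklore] -/
theorem c2c2_dicyclic_law_of_quot_cyclic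
    (hρρ : ∀ a b, ρ a * ρ b = ρ (a + b)) (hρτ : ∀ a b, ρ a * τ b = τ (b - a))
    (hτρ : ∀ a b, τ a * ρ b = τ (a + b)) (hττ : ∀ a b, τ a * τ b = ρ (c₀ + b - a)) (hc₀ : c₀ ≠ 0)
    (hρ : Function.Injective ρ) (hτ : Function.Injective τ) (hne : ∀ a b, ρ a ≠ τ b)
    (hsurj : ∀ g, (∃ a, ρ a = g) ∨ (∃ a, τ a = g)) (hmod : Fintype.card A % 3 = 1) (hA : 14 ≤ Fintype.card A)
    {g : A} (hg : ∀ x : A, x ∈ AddSubgroup.zmultiples g ∨ x + c₀ ∈ AddSubgroup.zmultiples g) :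
    (∀ S T U : Finset (Multiplicative (ZMod 2) × (Multiplicative (ZMod 2) × G)), TripleProductProperty S T U →
        3 * (S.card * T.card * U.card) + 32 ≤ 32 * Fintype.card A) ∧
    ∃ S T U : Finset (Multiplicative (ZMod 2) × (Multiplicative (ZMod 2) × G)), TripleProductProperty S T U ∧
      3 * (S.card * T.card * U.card) + 32 = 32 * Fintype.card A := by
  refine ⟨fun S T U h => ?_, ?_⟩
  · refine c2_product_presentation hρρ hρτ hτρ hττ hρ hτ hne hsurj
      fun ρ' τ' c₀' hρρ' hρτ' hτρ' hττ' hρ' hτ' hne' hsurj' hc' => ?_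
    subst hc'
    refine c2_product_presentation hρρ' hρτ' hτρ' hττ' hρ' hτ' hne' hsurj'
      fun ρ'' τ'' c₀'' hρρ'' hρτ'' hτρ'' hττ'' hρ'' hτ'' hne'' hsurj'' hc'' => ?_
    subst hc''
    have hc₀'' : (((0 : ZMod 2), (((0 : ZMod 2), c₀))) : ZMod 2 × (ZMod 2 × A)) ≠ 0 := fun h0 =>
      hc₀ (congrArg (fun p : ZMod 2 × (ZMod 2 × A) => p.2.2) h0)
    have hcard : Fintype.card (ZMod 2 × (ZMod 2 × A)) = 4 * Fintype.card A := by
      rw [Fintype.card_prod, Fintype.card_prod, ZMod.card]; ring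
    have key := tpp_volume_dicyclic_quot_noncyclic_le hρρ'' hρτ'' hτρ'' hττ'' hc₀'' (z2_z2_prod_quot_noncyclic c₀)
      hρ'' hτ'' hne'' hsurj'' (by rw [hcard]; omega) (by rw [hcard]; omega) h
    rw [hcard] at key
    omega
  · obtain ⟨S, T, U, h, hvol⟩ :=
      mod_one_law_attained_of_quot_cyclic hρρ hρτ hτρ hττ hc₀ hρ hτ hne hsurj hmod hA hg
    refine ⟨univ ×ˢ (univ ×ˢ S), {1} ×ˢ ({1} ×ˢ T), {1} ×ˢ ({1} ×ˢ U),
      tpp_product tpp_univ_one_one (tpp_product tpp_univ_one_one h), ?_⟩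
    simp only [card_product, card_univ, card_singleton, Fintype.card_multiplicative, ZMod.card]
    have e : 2 * (2 * S.card) * (1 * (1 * T.card)) * (1 * (1 * U.card)) = 4 * (S.card * T.card * U.card) := by ring
    rw [e]
    omega

end C2C2G

end Summit.MatrixMultiplication.OmegaCensus
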